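import Mathlib

/-!
# Venture HSemireg — MOD-4 line: upper-triangular matrices with TWO ZERO PIVOTS — the kernel is `1`- or `2`-dimensional according
# as ONE square «pin block» is regular or singular (the uniform form of every even-`n` pin criterion of the `ch(O_Z)`-shape rows)

HONEST FRAMING. Part of the Lean index of the computation cell `pub-hsemireg` (seat w3-mod4-1 gen 15, W3 SPECIAL FIBRES; file of
record `HOME/widen/W3/MOD4-OFFSPLIT-w3mod4.md` §13.30, last sentence: «only the pins farther from the centre have no uniform statement
yet — uniform form = a Schur-complement determinant», and §13.31). ELEMENTARY LINEAR ALGEBRA over a field ONLY (Mathlib import only):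
no abelian variety, no sheaf, no Ext group, no semiregularity map; nothing here says that HC / HC_CM / HC_AV holds; no Literature fact
is declared; NO definition is introduced.  Used by `Mod4LeadingTermPinCriterion` (`N = T_f − μ_a`).

SETTING: `N` an upper-triangular `(m+1) × (m+1)` matrix over a field `K` (`N.BlockTriangular id`), two indices `i ≤ i + k ≤ m`, the
pivots `N_{bb}`, `b ∉ {i, i+k}`, non-zero.  The **pin block** is the `k × k` matrix `B = (N_{i+r, i+1+s})_{r,s<k}` (rows `i, …, i+k−1`,
columns `i+1, …, i+k`); its sub-diagonal carries the non-zero pivots `N_{bb}`, `i < b < i+k`, so `rank B ≥ k − 1`.  (`B` enters as a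
hypothesis `hB : B = Matrix.of …` — no definition.)  WHAT IS PROVED:
* **`pivot_mul_eq_zero_of_row`** — a row of `Nv = 0` with every coordinate above it zero isolates its pivot term `N_{bb} v_b = 0`;
* **`mulVec_row_eq_pinBlock_mulVec`** — for `v` vanishing above `i + k` with `N_{ii} v_i = 0`: `(Nv)_{i+r} = (B v')_r`, `v'_s = v_{i+1+s}`;
* **`eq_zero_of_mulVec_eq_zero_of_det_pinBlock_ne_zero`** — `det B ≠ 0`, `Nv = 0`, `v_i = 0` ⇒ `v = 0` (back substitution above the
  block, Cramer on the block, back substitution below it): so `v ↦ v_i` is injective on `ker N` and `dim ker N ≤ 1`;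
* **`vecMul_pinBlock_head_ne_zero`** — a non-zero `u` with `u B = 0` has `u_0 ≠ 0` (forward substitution along the sub-diagonal pivots);
* **`two_le_finrank_ker_of_det_pinBlock_eq_zero`** — `N_{ii} = N_{i+k,i+k} = 0` and `det B = 0` ⇒ `dim ker N ≥ 2`, WITHOUT a solve: on
  `U = {v : v_b = 0, b > i+k}` (`dim = i+k+1`) the `i+k−1` coordinates `(Nv)_b`, `b < i+k`, `b ≠ i`, have a common kernel of dimension
  `≥ 2` by rank–nullity; it lies in `ker N` because the rows `b ≥ i+k` vanish on `U`, and row `i` is `(Bv')_0` with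
  `u_0·(Bv')_0 = (uB)·v' − Σ_{r≥1} u_r (Bv')_r = 0`.
Everything PROVED, 0 sorry. Namespace `Summit.Ventures.HSemireg.Mod4`. References: [BourbakiAlgebre1a3] Ch. III §8 (triangular
systems, rank); [BuchweitzFlenner2008HH] Prop. 6.4.4 (why these kernels are contraction ranks).
-/

namespace Summit.Ventures.HSemireg.Mod4

open Finset Matrix

variable {K : Type*} [Field K]

/-! ### Upper-triangular matrices with two zero pivots -/

section TwoZeroPivots

variable {m : ℕ} {N : Matrix (Fin (m + 1)) (Fin (m + 1)) K}

/-- a row `b` of `N v = 0` in which every coordinate above `b` vanishes isolates the pivot term `N_{bb} v_b = 0`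
(`N` upper triangular). [cite: BourbakiAlgebre1a3, Ch. III §8] -/
theorem pivot_mul_eq_zero_of_row (htri : N.BlockTriangular id) {v : Fin (m + 1) → K} (b : Fin (m + 1))
    (hrow : ∑ c : Fin (m + 1), N b c * v c = 0) (habove : ∀ c : Fin (m + 1), b < c → v c = 0) : N b b * v b = 0 := by
  rw [Finset.sum_eq_single b] at hrow
  · exact hrow
  · intro c _ hcb
    rcases lt_or_gt_of_ne hcb with h | h
    · rw [htri h, zero_mul]
    · rw [habove c h, mul_zero]
  · intro h
    exact absurd (Finset.mem_univ b) h

/-- **row-to-block:** for `v` vanishing above `i + k` with `N_{ii} v_i = 0`, row `i + r` of `N v` is row `r` of `B v'`, where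
`B = (N_{i+r,i+1+s})_{r,s<k}` is the pin block and `v'_s = v_{i+1+s}` (`N` upper triangular). [cite: BourbakiAlgebre1a3, Ch. III §8] -/
theorem mulVec_row_eq_pinBlock_mulVec (htri : N.BlockTriangular id) {i k : ℕ} (hik : i + k ≤ m)
    {B : Matrix (Fin k) (Fin k) K} (hB : B = Matrix.of fun r s : Fin k => N ⟨i + r, by omega⟩ ⟨i + 1 + s, by omega⟩)
    {v : Fin (m + 1) → K} (hv : ∀ c : Fin (m + 1), i + k < (c : ℕ) → v c = 0)
    (hii : N ⟨i, by omega⟩ ⟨i, by omega⟩ * v ⟨i, by omega⟩ = 0) (r : Fin k) :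
    (N *ᵥ v) ⟨i + r, by omega⟩ = (B *ᵥ fun s : Fin k => v ⟨i + 1 + s, by omega⟩) r := by
  have hr := r.isLt
  let e : Fin k ↪ Fin (m + 1) := ⟨fun s => ⟨i + 1 + s, by omega⟩, fun s s' h => by
    simp only [Fin.mk.injEq] at h
    exact Fin.ext (by omega)⟩
  simp only [Matrix.mulVec, dotProduct]
  have hsub : ∑ c ∈ (Finset.univ : Finset (Fin k)).map e, N ⟨i + r, by omega⟩ c * v c =
      ∑ c : Fin (m + 1), N ⟨i + r, by omega⟩ c * v c := by
    refine Finset.sum_subset (Finset.subset_univ _) fun c _ hc => ?_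
    have hcl := c.isLt
    have hc' : (c : ℕ) < i + 1 ∨ i + k < (c : ℕ) := by
      by_contra hcon
      exact hc (Finset.mem_map.mpr ⟨⟨(c : ℕ) - (i + 1), by omega⟩, Finset.mem_univ _, Fin.ext (by simp [e]; omega)⟩)
    rcases hc' with hc' | hc'
    · by_cases hlt : (c : ℕ) < i + r
      · rw [htri (show c < (⟨i + r, by omega⟩ : Fin (m + 1)) from hlt), zero_mul]
      · have hci : (c : ℕ) = i := by omega
        have hr0 : (r : ℕ) = 0 := by omega
        have hc2 : c = ⟨i, by omega⟩ := Fin.ext hci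
        have hri : (⟨i + r, by omega⟩ : Fin (m + 1)) = ⟨i, by omega⟩ := Fin.ext (by simp only; omega)
        rw [hc2, hri, hii]
    · rw [hv c hc', mul_zero]
  rw [← hsub, Finset.sum_map]
  refine Finset.sum_congr rfl fun s _ => ?_
  rw [hB, Matrix.of_apply]
  rfl

/-- **generic block ⇒ the kernel is read off `v_i`:** if the pivots of the upper-triangular `N` off `{i, i+k}` are non-zero and
the pin block `B` has `det B ≠ 0`, a kernel vector of `N` with `v_i = 0` vanishes (back substitution above the block, Cramer on the
block, back substitution below it). [cite: BourbakiAlgebre1a3, Ch. III §8] -/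
theorem eq_zero_of_mulVec_eq_zero_of_det_pinBlock_ne_zero (htri : N.BlockTriangular id) {i k : ℕ} (hik : i + k ≤ m)
    (hpiv : ∀ b : Fin (m + 1), (b : ℕ) ≠ i → (b : ℕ) ≠ i + k → N b b ≠ 0)
    {B : Matrix (Fin k) (Fin k) K} (hB : B = Matrix.of fun r s : Fin k => N ⟨i + r, by omega⟩ ⟨i + 1 + s, by omega⟩)
    (hdet : B.det ≠ 0) {v : Fin (m + 1) → K} (hv : N *ᵥ v = 0) (hvi : v ⟨i, by omega⟩ = 0) : v = 0 := by
  have hrow : ∀ b : Fin (m + 1), ∑ c : Fin (m + 1), N b c * v c = 0 := by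
    intro b
    have h := congr_fun hv b
    simp only [Matrix.mulVec, dotProduct, Pi.zero_apply] at h
    exact h
  -- Step 1: above the block, `v (m - j) = 0` for `m - j > i + k`, by strong induction on `j`
  have h1 : ∀ j, i + k < m - j → v ⟨m - j, by omega⟩ = 0 := by
    intro j
    refine Nat.strong_induction_on j ?_
    intro j ih hj
    set b : Fin (m + 1) := ⟨m - j, by omega⟩ with hb
    have hp := pivot_mul_eq_zero_of_row htri b (hrow b) (fun c hc => by
      have hcl := c.isLt
      have hc' : (b : ℕ) < (c : ℕ) := hc
      have h' := ih (m - (c : ℕ)) (by simp only [hb] at hc'; omega) (by simp only [hb] at hc'; omega)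
      have hfin : (⟨m - (m - (c : ℕ)), by omega⟩ : Fin (m + 1)) = c := Fin.ext (by simp only; omega)
      rwa [hfin] at h')
    rcases mul_eq_zero.mp hp with h | h
    · exact absurd h (hpiv b (by simp only [hb]; omega) (by simp only [hb]; omega))
    · exact h
  have h1' : ∀ c : Fin (m + 1), i + k < (c : ℕ) → v c = 0 := by
    intro c hc
    have hcl := c.isLt
    have h := h1 (m - (c : ℕ)) (by omega)
    have hfin : (⟨m - (m - (c : ℕ)), by omega⟩ : Fin (m + 1)) = c := Fin.ext (by simp only; omega)
    rwa [hfin] at h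
  -- Step 2: the block coordinates vanish by Cramer
  have h2 : (fun s : Fin k => v ⟨i + 1 + s, by omega⟩) = 0 := by
    refine Matrix.eq_zero_of_mulVec_eq_zero hdet ?_
    funext r
    rw [← mulVec_row_eq_pinBlock_mulVec htri hik hB h1' (by rw [hvi, mul_zero]) r, hv]
    rfl
  have h2' : ∀ c : Fin (m + 1), i < (c : ℕ) → (c : ℕ) ≤ i + k → v c = 0 := by
    intro c hc hc'
    have h := congr_fun h2 ⟨(c : ℕ) - (i + 1), by omega⟩
    have hfin : (⟨i + 1 + ((c : ℕ) - (i + 1)), by omega⟩ : Fin (m + 1)) = c := Fin.ext (by simp only; omega)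
    simp only [Pi.zero_apply, hfin] at h
    exact h
  -- Step 3: below `i`, `v (i - j) = 0` by strong induction on `j`
  have h3 : ∀ j, j ≤ i → v ⟨i - j, by omega⟩ = 0 := by
    intro j
    refine Nat.strong_induction_on j ?_
    intro j ih hj
    by_cases hj0 : j = 0
    · subst hj0
      exact hvi
    set b : Fin (m + 1) := ⟨i - j, by omega⟩ with hb
    have hp := pivot_mul_eq_zero_of_row htri b (hrow b) (fun c hc => by
      have hcl := c.isLt
      have hc' : (b : ℕ) < (c : ℕ) := hc
      simp only [hb] at hc'
      by_cases hci : i + k < (c : ℕ)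
      · exact h1' c hci
      · by_cases hci' : i < (c : ℕ)
        · exact h2' c hci' (by omega)
        · have h' := ih (i - (c : ℕ)) (by omega) (by omega)
          have hfin : (⟨i - (i - (c : ℕ)), by omega⟩ : Fin (m + 1)) = c := Fin.ext (by simp only; omega)
          rwa [hfin] at h')
    rcases mul_eq_zero.mp hp with h | h
    · exact absurd h (hpiv b (by simp only [hb]; omega) (by simp only [hb]; omega))
    · exact h
  funext c
  have hcl := c.isLt
  rw [Pi.zero_apply]
  by_cases hci : i + k < (c : ℕ)
  · exact h1' c hci
  · by_cases hci' : i < (c : ℕ)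
    · exact h2' c hci' (by omega)
    · have h := h3 (i - (c : ℕ)) (by omega)
      have hfin : (⟨i - (i - (c : ℕ)), by omega⟩ : Fin (m + 1)) = c := Fin.ext (by simp only; omega)
      rwa [hfin] at h

/-- **the head of a left kernel vector of the pin block is non-zero:** if the pivots `N_{bb}`, `i < b < i + k`, are non-zero
(they sit on the sub-diagonal `B_{s+1,s}` of the block) and `u B = 0`, `u ≠ 0`, then `u_0 ≠ 0` (forward substitution column by
column). [cite: BourbakiAlgebre1a3, Ch. III §8] -/
theorem vecMul_pinBlock_head_ne_zero (htri : N.BlockTriangular id) {i k : ℕ} (hik : i + k ≤ m)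
    (hpiv : ∀ b : Fin (m + 1), (b : ℕ) ≠ i → (b : ℕ) ≠ i + k → N b b ≠ 0)
    {B : Matrix (Fin k) (Fin k) K} (hB : B = Matrix.of fun r s : Fin k => N ⟨i + r, by omega⟩ ⟨i + 1 + s, by omega⟩)
    {u : Fin k → K} (hu0 : u ≠ 0) (huB : u ᵥ* B = 0) (hk : 0 < k) : u ⟨0, hk⟩ ≠ 0 := by
  intro h0
  -- forward substitution: `u (s + 1) = 0` for all `s + 1 < k`
  have key : ∀ s : ℕ, ∀ hs : s + 1 < k, u ⟨s + 1, hs⟩ = 0 := by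
    intro s
    refine Nat.strong_induction_on s ?_
    intro s ih hs
    have hcol := congr_fun huB ⟨s, by omega⟩
    simp only [Matrix.vecMul, dotProduct, Pi.zero_apply] at hcol
    rw [Finset.sum_eq_single ⟨s + 1, hs⟩] at hcol
    · have hBss : B ⟨s + 1, hs⟩ ⟨s, by omega⟩ = N ⟨i + (s + 1), by omega⟩ ⟨i + (s + 1), by omega⟩ := by
        rw [hB, Matrix.of_apply]
        exact congrArg _ (Fin.ext (by simp only; omega))
      rw [hBss] at hcol
      rcases mul_eq_zero.mp hcol with h | h
      · exact h
      · exact absurd h (hpiv _ (by simp only; omega) (by simp only; omega))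
    · intro r _ hr
      have hrl := r.isLt
      by_cases hlt : s + 1 < (r : ℕ)
      · -- below the sub-diagonal of the block: a triangular zero of `N`
        rw [hB, Matrix.of_apply, htri (show (⟨i + 1 + s, by omega⟩ : Fin (m + 1)) < ⟨i + r, by omega⟩ from by
          show i + 1 + s < i + (r : ℕ); omega), mul_zero]
      · have hrle : (r : ℕ) ≤ s := by
          have : (r : ℕ) ≠ s + 1 := fun h => hr (Fin.ext h)
          omega
        rcases Nat.eq_zero_or_pos (r : ℕ) with hr0 | hr0
        · have : r = ⟨0, hk⟩ := Fin.ext hr0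
          rw [this, h0, zero_mul]
        · have h' := ih ((r : ℕ) - 1) (by omega) (by omega)
          have hfin : (⟨(r : ℕ) - 1 + 1, by omega⟩ : Fin k) = r := Fin.ext (by simp only; omega)
          rw [hfin] at h'
          rw [h', zero_mul]
    · intro h
      exact absurd (Finset.mem_univ _) h
  apply hu0
  funext r
  have hrl := r.isLt
  rw [Pi.zero_apply]
  rcases Nat.eq_zero_or_pos (r : ℕ) with hr0 | hr0
  · have : r = ⟨0, hk⟩ := Fin.ext hr0
    rw [this, h0]
  · have h' := key ((r : ℕ) - 1) (by omega)
    have hfin : (⟨(r : ℕ) - 1 + 1, by omega⟩ : Fin k) = r := Fin.ext (by simp only; omega)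
    rwa [hfin] at h'

/-- **degenerate block ⇒ `dim ker N ≥ 2`, without a solve:** `N` upper triangular with zero pivots at `i` and `i + k`, non-zero
pivots elsewhere, and pin block `B` with `det B = 0`.  On `U = {v : v_b = 0 for b > i + k}` (dimension `i + k + 1`) the `i + k − 1`
linear forms `(Nv)_b` (`b < i + k`, `b ≠ i`) have a common kernel of dimension `≥ 2` (rank–nullity), and that kernel lies in `ker N`:
the rows `b ≥ i + k` vanish on `U` by triangularity and `N_{i+k,i+k} = 0`, and row `i` equals `(Bv')_0`, which is killed by a left
kernel vector `u` of `B` with `u_0 ≠ 0`. [cite: BourbakiAlgebre1a3, Ch. III §8] -/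
theorem two_le_finrank_ker_of_det_pinBlock_eq_zero (htri : N.BlockTriangular id) {i k : ℕ} (hik : i + k ≤ m)
    (hpiv : ∀ b : Fin (m + 1), (b : ℕ) ≠ i → (b : ℕ) ≠ i + k → N b b ≠ 0)
    (hNi : N ⟨i, by omega⟩ ⟨i, by omega⟩ = 0) (hNik : N ⟨i + k, by omega⟩ ⟨i + k, by omega⟩ = 0)
    {B : Matrix (Fin k) (Fin k) K} (hB : B = Matrix.of fun r s : Fin k => N ⟨i + r, by omega⟩ ⟨i + 1 + s, by omega⟩)
    (hdet : B.det = 0) : 2 ≤ Module.finrank K ↥(LinearMap.ker (Matrix.toLin' N)) := by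
  obtain ⟨u, hu0, huB⟩ := Matrix.exists_vecMul_eq_zero_iff.mpr hdet
  have hk : 0 < k := by
    rcases Nat.eq_zero_or_pos k with h | h
    · subst h
      exact absurd (funext fun s => Fin.elim0 s) hu0
    · exact h
  have hu00 : u ⟨0, hk⟩ ≠ 0 := vecMul_pinBlock_head_ne_zero htri hik hpiv hB hu0 huB hk
  -- `ι`: extension by zero from the first `i + k + 1` coordinates
  let ι : (Fin (i + k + 1) → K) →ₗ[K] (Fin (m + 1) → K) :=
    { toFun := fun w c => if h : (c : ℕ) < i + k + 1 then w ⟨c, h⟩ else 0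
      map_add' := by intro w w'; funext c; simp only [Pi.add_apply]; split_ifs <;> simp
      map_smul' := by intro r w; funext c; simp only [Pi.smul_apply, smul_eq_mul, RingHom.id_apply]; split_ifs <;> simp }
  have hι_lt : ∀ w (c : Fin (m + 1)) (h : (c : ℕ) < i + k + 1), ι w c = w ⟨c, h⟩ := by
    intro w c h; show (if h : (c : ℕ) < i + k + 1 then w ⟨c, h⟩ else 0) = _; rw [dif_pos h]
  have hι_ge : ∀ w (c : Fin (m + 1)), i + k + 1 ≤ (c : ℕ) → ι w c = 0 := by
    intro w c h; show (if h : (c : ℕ) < i + k + 1 then w ⟨c, h⟩ else 0) = _; rw [dif_neg (by omega)]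
  -- `τ`: the `i + (k - 1)` rows `b < i` and `i < b < i + k`
  let τ : Fin (i + (k - 1)) → Fin (m + 1) := fun j => if (j : ℕ) < i then ⟨j, by omega⟩ else ⟨j + 1, by omega⟩
  let ψ : (Fin (i + k + 1) → K) →ₗ[K] (Fin (i + (k - 1)) → K) :=
    (LinearMap.pi fun j : Fin (i + (k - 1)) => LinearMap.proj (τ j)) ∘ₗ Matrix.toLin' N ∘ₗ ι
  -- rank–nullity for `ψ`
  have hkerψ : 2 ≤ Module.finrank K ↥(LinearMap.ker ψ) := by
    have h1 := LinearMap.finrank_range_add_finrank_ker ψ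
    have h2 : Module.finrank K ↥(LinearMap.range ψ) ≤ i + (k - 1) := by
      have := Submodule.finrank_le (LinearMap.range ψ)
      rwa [Module.finrank_fin_fun] at this
    rw [Module.finrank_fin_fun] at h1
    omega
  -- every `w ∈ ker ψ` gives a kernel vector `ι w` of `N`
  have hmem : ∀ w : Fin (i + k + 1) → K, ψ w = 0 → N *ᵥ ι w = 0 := by
    intro w hw
    have hcoord : ∀ j : Fin (i + (k - 1)), (N *ᵥ ι w) (τ j) = 0 := by
      intro j
      have := congr_fun hw j
      simpa [ψ, LinearMap.pi_apply, Matrix.toLin'_apply] using this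
    have habove : ∀ c : Fin (m + 1), i + k < (c : ℕ) → ι w c = 0 := fun c hc => hι_ge w c (by omega)
    -- all rows except `i`
    have hne : ∀ b : Fin (m + 1), (b : ℕ) ≠ i → (N *ᵥ ι w) b = 0 := by
      intro b hbi
      have hbl := b.isLt
      by_cases hbig : i + k ≤ (b : ℕ)
      · -- rows `b ≥ i + k`
        simp only [Matrix.mulVec, dotProduct]
        refine Finset.sum_eq_zero fun c _ => ?_
        have hcl := c.isLt
        by_cases hcb : (c : ℕ) < (b : ℕ)
        · rw [htri (show c < b from hcb), zero_mul]
        · by_cases hce : c = b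
          · rw [hce]
            by_cases hbk : (b : ℕ) = i + k
            · have : b = ⟨i + k, by omega⟩ := Fin.ext hbk
              rw [this, hNik, zero_mul]
            · rw [habove b (by omega), mul_zero]
          · have : (c : ℕ) ≠ (b : ℕ) := fun h => hce (Fin.ext h)
            rw [habove c (by omega), mul_zero]
      · by_cases hlt : (b : ℕ) < i
        · have h := hcoord ⟨b, by omega⟩
          have hτ : τ ⟨b, by omega⟩ = b := by simp only [τ]; rw [if_pos hlt]
          rwa [hτ] at h
        · have h := hcoord ⟨(b : ℕ) - 1, by omega⟩
          have hτ : τ ⟨(b : ℕ) - 1, by omega⟩ = b := by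
            simp only [τ]
            rw [if_neg (by omega)]
            exact Fin.ext (by simp only; omega)
          rwa [hτ] at h
    -- row `i` through the block and the left kernel vector `u`
    have hrowi : (N *ᵥ ι w) ⟨i, by omega⟩ = 0 := by
      set w' : Fin k → K := fun s => ι w ⟨i + 1 + s, by omega⟩ with hw'
      have hblock : ∀ r : Fin k, (N *ᵥ ι w) ⟨i + r, by omega⟩ = (B *ᵥ w') r :=
        fun r => mulVec_row_eq_pinBlock_mulVec htri hik hB habove (by rw [hNi, zero_mul]) r
      have htail : ∀ r : Fin k, r ≠ ⟨0, hk⟩ → (B *ᵥ w') r = 0 := by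
        intro r hr
        have hr' : (r : ℕ) ≠ 0 := fun h => hr (Fin.ext h)
        rw [← hblock r]
        exact hne _ (by simp only; omega)
      have hdot : u ⬝ᵥ (B *ᵥ w') = 0 := by rw [Matrix.dotProduct_mulVec, huB, zero_dotProduct]
      rw [dotProduct, Finset.sum_eq_single ⟨0, hk⟩ (fun r _ hr => by rw [htail r hr, mul_zero])
        (fun h => absurd (Finset.mem_univ _) h)] at hdot
      have h0 : (B *ᵥ w') ⟨0, hk⟩ = 0 := (mul_eq_zero.mp hdot).resolve_left hu00
      have := hblock ⟨0, hk⟩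
      simp only [add_zero] at this
      rw [this, h0]
    funext b
    rw [Pi.zero_apply]
    by_cases hbi : (b : ℕ) = i
    · have : b = ⟨i, by omega⟩ := Fin.ext hbi
      rw [this, hrowi]
    · exact hne b hbi
  -- the injective linear map `ker ψ → ker N`
  let g : ↥(LinearMap.ker ψ) →ₗ[K] ↥(LinearMap.ker (Matrix.toLin' N)) :=
    { toFun := fun w => ⟨ι w.1, by rw [LinearMap.mem_ker, Matrix.toLin'_apply]; exact hmem w.1 w.2⟩
      map_add' := by intro w w'; apply Subtype.ext; simp
      map_smul' := by intro r w; apply Subtype.ext; simp }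
  have hg : Function.Injective g := by
    intro w w' h
    have h' : ι w.1 = ι w'.1 := congrArg Subtype.val h
    apply Subtype.ext
    funext c
    have := congr_fun h' ⟨c, by omega⟩
    rwa [hι_lt w.1 ⟨c, by omega⟩ c.isLt, hι_lt w'.1 ⟨c, by omega⟩ c.isLt] at this
  exact le_trans hkerψ (LinearMap.finrank_le_finrank_of_injective hg)

end TwoZeroPivots

end Summit.Ventures.HSemireg.Mod4
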